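import Summits.AtomisticToContinuum.FouriersLaw.Theorems.ContactStieltjesMeasureStieltjesRepresentationPencilPoisson
import Summits.AtomisticToContinuum.FouriersLaw.Theorems.ContactStieltjesMeasureStieltjesRepresentationPencilIBP

/-!
# Stub `stub_pencilOfGreenKubo` of line `cayley-pencil` (crux `ContactStieltjesMeasure.StieltjesRepresentation`,
# stmt-AtomisticToContinuum-15248), part 6a: the boundary field and the Green–Kubo link

Helper file (`--supports stmt-AtomisticToContinuum-15248`). Pinned anharmonic chain `P = pinnedChain ω₂ lam β γ`
(`ω₂, β, γ > 0`, `lam ≥ 0`), `N ≥ 2`, `T > 0`, `ρ = e^{-H/T}`, equilibrium kernels `P_t`.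

* `boundaryField_nice` — the BOUNDARY FIELD `G = (∂_{q_0}H/√T, 0)` is a nice field (smooth, `|G_b|, |∂_{p_b}G_b| ≤ A e^{H/(16T)}`,
  indeed `∂_{p_b}G_0 = 0`), and its adjoint field is the scaled boundary power: `D*G = √T·p_0·(∂_{q_0}H/√T)/T = g₀/T`,
  `g₀ = p_0 ∂_{q_0}H`.
* `link_pairing` — for the Poisson solution `w` of `L_γ w = -g₀/T` (smooth, `O(e^{H/(8T)})`, decaying forecasts, a.e. the
  forward integral): `t ↦ ∫ g₀·P_t g₀ ρ` is integrable on `(0,∞)` and `∫ (g₀/T)·w ρ = T⁻²·∫₀^∞ ∫ g₀·P_t g₀ ρ dt`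
  (Fubini for forecast pairings, part 3). This is the diagonal matrix element `⟪g, W(γ) g⟫` of the pencil up to `Z⁻¹`.
No definitions.
-/

noncomputable section

open MeasureTheory Filter Topology Set Function
open scoped ContDiff NNReal
open Literature.MathematicalPhysics.KineticTheory.HeatConduction

namespace Summit.AtomisticToContinuum.FouriersLaw.Theorems.ContactStieltjesMeasure.CayleyPencil

namespace Pencil

variable {N : ℕ}

section Pinned

variable {ω₂ lam β γ : ℝ} (hω : 0 < ω₂) (hl : 0 ≤ lam) (hβ : 0 < β) (hγ : 0 < γ) (hN : 2 ≤ N) {T : ℝ} (hT : 0 < T)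
include hω hl hβ hγ hN hT

omit hβ hγ in
/-- **The boundary field is nice and its adjoint field is `g₀/T`.** With `G₀ = ∂_{q_0}H/√T`, `G₁ = 0` (`β ≥ 0`):
`G₀ ∈ C^∞`, `∂_{p_b}G₀ = 0`, `|G₀| ≤ A e^{H/(16T)}`, and `√T(-∂_{p_0}G₀ + p_0G₀/T) + √T(-∂_{p_{N-1}}0 + p_{N-1}·0/T) =
p_0∂_{q_0}H/T`. [folklore] -/
theorem boundaryField_nice (hβ' : 0 ≤ β) :
    ContDiff ℝ ∞ (fun x : PhaseSpace N => partialQ ⟨0, by omega⟩ ((pinnedChain ω₂ lam β γ).hamiltonian N) x / Real.sqrt T) ∧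
    (∀ (i : Fin N) (x : PhaseSpace N),
      partialP i (fun y : PhaseSpace N => partialQ ⟨0, by omega⟩ ((pinnedChain ω₂ lam β γ).hamiltonian N) y / Real.sqrt T)
        x = 0) ∧
    (∃ A : ℝ, 0 ≤ A ∧ ∀ y : PhaseSpace N,
      |partialQ ⟨0, by omega⟩ ((pinnedChain ω₂ lam β γ).hamiltonian N) y / Real.sqrt T| ≤
          A * Real.exp ((pinnedChain ω₂ lam β γ).hamiltonian N y / (16 * T)) ∧
      |partialP ⟨0, by omega⟩ (fun y : PhaseSpace N =>
          partialQ ⟨0, by omega⟩ ((pinnedChain ω₂ lam β γ).hamiltonian N) y / Real.sqrt T) y| ≤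
          A * Real.exp ((pinnedChain ω₂ lam β γ).hamiltonian N y / (16 * T)) ∧
      |(fun _ : PhaseSpace N => (0 : ℝ)) y| ≤ A * Real.exp ((pinnedChain ω₂ lam β γ).hamiltonian N y / (16 * T)) ∧
      |partialP ⟨N - 1, by omega⟩ (fun _ : PhaseSpace N => (0 : ℝ)) y| ≤
          A * Real.exp ((pinnedChain ω₂ lam β γ).hamiltonian N y / (16 * T))) ∧
    ∀ x : PhaseSpace N,
      Real.sqrt T * (-partialP ⟨0, by omega⟩ (fun y : PhaseSpace N =>
          partialQ ⟨0, by omega⟩ ((pinnedChain ω₂ lam β γ).hamiltonian N) y / Real.sqrt T) x +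
        x.2 ⟨0, by omega⟩ * (partialQ ⟨0, by omega⟩ ((pinnedChain ω₂ lam β γ).hamiltonian N) x / Real.sqrt T) / T) +
      Real.sqrt T * (-partialP ⟨N - 1, by omega⟩ (fun _ : PhaseSpace N => (0 : ℝ)) x +
        x.2 ⟨N - 1, by omega⟩ * (fun _ : PhaseSpace N => (0 : ℝ)) x / T) =
      x.2 ⟨0, by omega⟩ * partialQ ⟨0, by omega⟩ ((pinnedChain ω₂ lam β γ).hamiltonian N) x / T := by
  set P := pinnedChain ω₂ lam β γ with hP
  set b₀ : Fin N := ⟨0, by omega⟩ with hb₀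
  have hU : ContDiff ℝ ∞ P.U := pinnedChain_contDiff_U ω₂ lam β γ
  have hV : ContDiff ℝ ∞ P.V := pinnedChain_contDiff_V ω₂ lam β γ
  have hH : ContDiff ℝ ∞ (P.hamiltonian N) := P.contDiff_hamiltonian hU hV N
  have hHd : Differentiable ℝ (P.hamiltonian N) := hH.differentiable (by simp)
  have hsT : 0 < Real.sqrt T := Real.sqrt_pos.2 hT
  -- smoothness of `∂_{q_0}H`
  have hdQ : ContDiff ℝ ∞ (partialQ b₀ (P.hamiltonian N)) := by
    rw [partialQ_eq_fderiv hHd]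
    exact (hH.fderiv_right (m := ∞) (by norm_cast)).clm_apply contDiff_const
  have hG : ContDiff ℝ ∞ (fun x : PhaseSpace N => partialQ b₀ (P.hamiltonian N) x / Real.sqrt T) := hdQ.div_const _
  -- `∂_{p_i} G₀ = 0` (`∂_{q_0}H` depends on the positions only)
  have hdP : ∀ (i : Fin N) (x : PhaseSpace N),
      partialP i (fun y : PhaseSpace N => partialQ b₀ (P.hamiltonian N) y / Real.sqrt T) x = 0 := by
    intro i x
    unfold partialP
    simp only [P.partialQ_hamiltonian_eq]
    exact deriv_const _ _
  have hdP0 : ∀ (i : Fin N) (x : PhaseSpace N), partialP i (fun _ : PhaseSpace N => (0 : ℝ)) x = 0 := by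
    intro i x; unfold partialP; exact deriv_const _ _
  -- the bound `|∂_{q_0}H| ≤ (A+N²B)(1+H) ≤ (A+N²B)(1+16T) e^{H/(16T)}`
  have hconf := SubdiffusiveBondHeat.pinnedChain_isConfining (γ := 0) hω hl hβ' le_rfl
  obtain ⟨A, hA0, hA⟩ := hconf.exists_abs_deriv_U_le
  obtain ⟨B, hB0, hB⟩ := hconf.exists_abs_deriv_V_le
  set C : ℝ := (A + N ^ 2 * B) * (1 + 16 * T) / Real.sqrt T with hC
  have hC0 : 0 ≤ C := by positivity
  have hbound : ∀ y : PhaseSpace N, |partialQ b₀ (P.hamiltonian N) y / Real.sqrt T| ≤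
      C * Real.exp (P.hamiltonian N y / (16 * T)) := by
    intro y
    have hF := LinearResponseFTUR.abs_partialQ_hamiltonian_le hconf.U_nonneg hconf.V_nonneg hA0 hB0 hA hB
      hconf.differentiable_U hconf.differentiable_V y b₀
    set Hy := P.hamiltonian N y with hHy
    have hH0 : 0 ≤ Hy := pinnedChain_hamiltonian_nonneg hω.le hl hβ' γ N y
    have h1 : 1 ≤ Real.exp (Hy / (16 * T)) := Real.one_le_exp (by positivity)
    have h2 : Hy / (16 * T) ≤ Real.exp (Hy / (16 * T)) := by
      have := Real.add_one_le_exp (Hy / (16 * T)); linarith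
    have h3 : Hy ≤ 16 * T * Real.exp (Hy / (16 * T)) := by
      rw [div_le_iff₀ (by positivity)] at h2; linarith
    have h4 : 1 + Hy ≤ (1 + 16 * T) * Real.exp (Hy / (16 * T)) := by linarith
    rw [abs_div, abs_of_pos hsT, div_le_iff₀ hsT]
    calc |partialQ b₀ (P.hamiltonian N) y| ≤ (A + N ^ 2 * B) * (1 + Hy) := hF
      _ ≤ (A + N ^ 2 * B) * ((1 + 16 * T) * Real.exp (Hy / (16 * T))) :=
          mul_le_mul_of_nonneg_left h4 (by positivity)
      _ = C * Real.exp (Hy / (16 * T)) * Real.sqrt T := by rw [hC]; field_simp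
  refine ⟨hG, hdP, ⟨C, hC0, fun y => ⟨hbound y, ?_, ?_, ?_⟩⟩, fun x => ?_⟩
  · rw [hdP, abs_zero]; positivity
  · rw [abs_zero]; positivity
  · rw [hdP0, abs_zero]; positivity
  · rw [hdP, hdP0]
    field_simp
    ring

/-- **The Green–Kubo link.** With `g₀ = p_0∂_{q_0}H` and the Poisson solution `w` of `L_γ w = -g₀/T` in the form delivered
by `exists_poisson_solution` (decaying forecasts of `g₀/T`, a.e. the forward integral): `t ↦ ∫ g₀·(P_t g₀) ρ` is
integrable on `(0,∞)` and `∫ (g₀/T)·w ρ = T⁻²·∫₀^∞ ∫ g₀·(P_t g₀) ρ dt`. [folklore] -/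
theorem link_pairing {w : PhaseSpace N → ℝ} {M c : ℝ} (hc : 0 < c)
    (hdecay : ∀ (t : ℝ≥0) (z : PhaseSpace N),
      |∫ y, (fun x : PhaseSpace N => x.2 ⟨0, by omega⟩ *
          partialQ ⟨0, by omega⟩ ((pinnedChain ω₂ lam β γ).hamiltonian N) x / T) y
        ∂((pinnedChain ω₂ lam β γ).transitionKernel N T T t z)| ≤
        M * Real.exp ((pinnedChain ω₂ lam β γ).hamiltonian N z / (8 * T)) * Real.exp (-c * t))
    (hae : (fun x => ∫ t in Ioi (0 : ℝ), ∫ y, (fun x : PhaseSpace N => x.2 ⟨0, by omega⟩ *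
          partialQ ⟨0, by omega⟩ ((pinnedChain ω₂ lam β γ).hamiltonian N) x / T) y
        ∂((pinnedChain ω₂ lam β γ).transitionKernel N T T t.toNNReal x)) =ᵐ[volume] w) :
    IntegrableOn (fun t : ℝ => ∫ z, (z.2 ⟨0, by omega⟩ * partialQ ⟨0, by omega⟩ ((pinnedChain ω₂ lam β γ).hamiltonian N) z) *
        (∫ y, y.2 ⟨0, by omega⟩ * partialQ ⟨0, by omega⟩ ((pinnedChain ω₂ lam β γ).hamiltonian N) y
          ∂((pinnedChain ω₂ lam β γ).transitionKernel N T T t.toNNReal z)) *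
        (pinnedChain ω₂ lam β γ).gibbsDensity N T z) (Ioi 0) ∧
    ∫ x, (x.2 ⟨0, by omega⟩ * partialQ ⟨0, by omega⟩ ((pinnedChain ω₂ lam β γ).hamiltonian N) x / T) * w x *
        (pinnedChain ω₂ lam β γ).gibbsDensity N T x =
      (T ^ 2)⁻¹ * ∫ t in Ioi (0 : ℝ), ∫ z, (z.2 ⟨0, by omega⟩ *
          partialQ ⟨0, by omega⟩ ((pinnedChain ω₂ lam β γ).hamiltonian N) z) *
        (∫ y, y.2 ⟨0, by omega⟩ * partialQ ⟨0, by omega⟩ ((pinnedChain ω₂ lam β γ).hamiltonian N) y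
          ∂((pinnedChain ω₂ lam β γ).transitionKernel N T T t.toNNReal z)) *
        (pinnedChain ω₂ lam β γ).gibbsDensity N T z := by
  set P := pinnedChain ω₂ lam β γ with hP
  set ρ := P.gibbsDensity N T with hρ
  set b₀ : Fin N := ⟨0, by omega⟩ with hb₀
  have hN0 : 0 < N := by omega
  set g₀ : PhaseSpace N → ℝ := fun x => x.2 b₀ * partialQ b₀ (P.hamiltonian N) x with hg₀
  set v : PhaseSpace N → ℝ := fun x => x.2 b₀ * partialQ b₀ (P.hamiltonian N) x / T with hv
  have hϑ : (0 : ℝ) < 1 / (8 * T) := by positivity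
  have h2ϑ : 2 * (1 / (8 * T)) < 1 / T := by
    rw [show 2 * (1 / (8 * T)) = 1 / (4 * T) by field_simp; ring, div_lt_div_iff_of_pos_left one_pos (by positivity) hT]
    linarith
  obtain ⟨Cg, hCg0, hgb⟩ := BoundaryGreenKubo.abs_boundaryPower_le (N := N) hω hl hβ.le hγ.le hN0 hϑ
  have hg₀c : Continuous g₀ := BoundaryGreenKubo.continuous_boundaryPower ω₂ lam β γ hN0
  have hvc : Continuous v := hg₀c.div_const T
  have hvb : ∀ y, |v y| ≤ Cg / T * Real.exp (1 / (8 * T) * P.hamiltonian N y) := fun y => by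
    simp only [hv]
    rw [abs_div, abs_of_pos hT, div_le_iff₀ hT]
    calc |y.2 b₀ * partialQ b₀ (P.hamiltonian N) y| ≤ Cg * Real.exp (1 / (8 * T) * P.hamiltonian N y) := hgb y
      _ = Cg / T * Real.exp (1 / (8 * T) * P.hamiltonian N y) * T := by field_simp
  have hdecay' : ∀ (t : ℝ≥0) (z : PhaseSpace N), |∫ y, v y ∂(P.transitionKernel N T T t z)| ≤
      M * Real.exp (1 / (8 * T) * P.hamiltonian N z) * Real.exp (-c * t) := fun t z => by
    have h := hdecay t z
    rwa [exp_div_eight_eq (ω₂ := ω₂) (lam := lam) (β := β) (γ := γ) (T := T) z] at h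
  obtain ⟨hint, hfub⟩ := pairing_fubini_nn hω hβ hT hl hγ.le h2ϑ hc hvc hvc hvb hdecay'
  rw [← hP] at hint hfub
  -- the time slices: `∫ v P_t v ρ = T⁻² ∫ g₀ P_t g₀ ρ`
  have hslice : ∀ t : ℝ, ∫ z, v z * (∫ y, v y ∂(P.transitionKernel N T T t.toNNReal z)) * ρ z =
      (T ^ 2)⁻¹ * ∫ z, g₀ z * (∫ y, g₀ y ∂(P.transitionKernel N T T t.toNNReal z)) * ρ z := by
    intro t
    rw [← integral_const_mul]
    refine integral_congr_ae (Eventually.of_forall fun z => ?_)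
    have e : ∫ y, v y ∂(P.transitionKernel N T T t.toNNReal z) = (∫ y, g₀ y ∂(P.transitionKernel N T T t.toNNReal z)) / T := by
      simp only [hv, hg₀]; exact integral_div T _
    show v z * (∫ y, v y ∂(P.transitionKernel N T T t.toNNReal z)) * ρ z =
      (T ^ 2)⁻¹ * (g₀ z * (∫ y, g₀ y ∂(P.transitionKernel N T T t.toNNReal z)) * ρ z)
    rw [e]; simp only [hv, hg₀]; field_simp
  refine ⟨?_, ?_⟩
  · have h := hint.const_mul (T ^ 2)
    refine h.congr (Eventually.of_forall fun t => ?_)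
    show T ^ 2 * ∫ z, v z * (∫ y, v y ∂(P.transitionKernel N T T t.toNNReal z)) * ρ z = _
    rw [hslice t, ← mul_assoc, mul_inv_cancel₀ (by positivity), one_mul]
  · -- `∫ v w ρ = ∫ v (∫₀^∞ P_t v) ρ = ∫₀^∞ ∫ v P_t v ρ = T⁻² ∫₀^∞ ∫ g₀ P_t g₀ ρ`
    have e1 : ∫ x, v x * w x * ρ x =
        ∫ x, v x * (∫ t in Ioi (0 : ℝ), ∫ y, v y ∂(P.transitionKernel N T T t.toNNReal x)) * ρ x := by
      refine integral_congr_ae ?_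
      filter_upwards [hae] with x hx
      rw [← hx]
    rw [e1, ← hfub]
    rw [show (fun t : ℝ => ∫ z, v z * (∫ y, v y ∂(P.transitionKernel N T T t.toNNReal z)) * ρ z) =
        fun t : ℝ => (T ^ 2)⁻¹ * ∫ z, g₀ z * (∫ y, g₀ y ∂(P.transitionKernel N T T t.toNNReal z)) * ρ z from
      funext hslice]
    exact integral_const_mul _ _

end Pinned

end Pencil

/-! ## Registered helper stub -/

open Pencil in
/-- **Registered sub-goal `stub_pencilOfGreenKubo_boundaryField`** of the crux (this file's ticket): the boundary field
`∂_{q_0}H/√T` has vanishing momentum derivatives (second clause of `Pencil.boundaryField_nice`). [folklore] -/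
theorem stub_pencilOfGreenKubo_boundaryField :
    ∀ (N : ℕ) (ω₂ lam β γ : ℝ), 0 < ω₂ → 0 ≤ lam → 0 ≤ β → ∀ (hN : 2 ≤ N) (T : ℝ), 0 < T → ∀ (h0 : 0 < N) (i : Fin N) (x : Literature.MathematicalPhysics.KineticTheory.HeatConduction.PhaseSpace N), Literature.MathematicalPhysics.KineticTheory.HeatConduction.partialP i (fun y : Literature.MathematicalPhysics.KineticTheory.HeatConduction.PhaseSpace N => Literature.MathematicalPhysics.KineticTheory.HeatConduction.partialQ ⟨0, h0⟩ ((Literature.MathematicalPhysics.KineticTheory.HeatConduction.pinnedChain ω₂ lam β γ).hamiltonian N) y / Real.sqrt T) x = 0 :=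
  fun _ _ _ _ γ hω hl hβ hN _ hT _ i x => (boundaryField_nice (γ := γ) hω hl hN hT hβ).2.1 i x

end Summit.AtomisticToContinuum.FouriersLaw.Theorems.ContactStieltjesMeasure.CayleyPencil

end
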